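import Literature.Probability.RandomPlanarGeometry.SAWUnfoldingStep
import HarnessLib

/-!
# Inserting a bridge at the last maximum: `c_n · b_M ≤ (n+1) · c_{n+M}` on `ℤ^d` (every `d ≥ 1`)

Topic `Literature/Probability/RandomPlanarGeometry` (continues `SAWBridges.lean`: `Zd.saws`, `Zd.count`, `Zd.bridges`,
`Zd.bridgeCount`, `Zd.IsBridge`; `SAWUnfoldingStep.lean`: the reflection `Zd.reflCoord` of the first coordinate,
`Zd.zdGraph_adj_reflCoord`, `Zd.maxLevel`, `Zd.lastArgmax`).  Twin of `SAWTriangularBridgeInsertion.lean` (the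
same device on the triangular lattice, where it feeds the `N^{-1/3}` ratio rate); the proofs are the same word for
word — the construction uses only translations, the reflection of the first coordinate and the strictness of the
LAST maximum, never the particular step set.

Sources. N. Madras, G. Slade, *The Self-Avoiding Walk* (1993): §1.2, eq. (1.2.15) (concatenation with a bridge),
§8.1, proof of Proposition 8.1.2 and Figure 8.1 (the reflection `T_M` of the piece of a walk after its maximum in
the hyperplane `x₁ = M`, there turning a polygon into a bridge), §3.1, proof of Proposition 3.1.5 (the
Hammersley–Welsh unfolding [cite: HammersleyWelsh1962]), Lemma 7.3.3 and §7.5, eqs. (7.5.1)–(7.5.2) (Kesten 1963: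
insertion inequalities with polynomial loss are the super-multiplicativity input of the `N^{-1/3}` ratio rates).
The counting inequality itself we have not located in print in this form.  Construction: `j` = the LAST time the
first coordinate of the `n`-step walk `ω` is maximal (`= D`), `p = ω(j)`, `β` an `M`-step bridge; the new
`(n+M)`-step walk is `ω[0..j] · (p + β) · σ(ω[j+1..n])` with `p' = p + β(M)`,
`σ(y) = p' − w + R(y − ω(j+1))`, `w = ω(j+1) − ω(j)` (the step out of the last maximum, necessarily `−e₁`),
`R = Zd.reflCoord 0`.  The three blocks occupy the first-coordinate ranges `≤ D`, `(D, D + β(M)₁]`,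
`> D + β(M)₁`; `σ(ω(j+1)) = p' − w ~ p'`; for fixed `j` the map is injective; summing over `j ≤ n` gives the
factor `n + 1`.

## Main statements (namespace `Literature.Probability.RandomPlanarGeometry.SAW.Zd`)

* `BridgeInsertion.insertBridge`, `insertBridge_mem_saws`, `insertBridge_injective`, `lastMaxClass`,
  `saws_subset_biUnion_lastMaxClass`, `card_lastMaxClass_mul_bridgeCount_le`;
* **`count_mul_bridgeCount_le : c_n · b_M ≤ (n+1) · c_{n+M}`** (every `d ≥ 1`, all `n, M`), `…_real`, and the
  sandwich `count_mul_bridgeCount_le_and` with submultiplicativity.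
-/

noncomputable section

open Finset Function Literature.Probability.LatticeModels SimpleGraph
open scoped BigOperators

namespace Literature.Probability.RandomPlanarGeometry.SAW.Zd

variable {d : ℕ} [NeZero d]

namespace BridgeInsertion

/-! ### The reflection–translation `σ` -/

/-- `σ_{c,a}(y) = c + R(y − a)`, `R` the reflection `X ↦ −X` of the height: the composition of a height
reflection with a translation, normalised by `σ_{c,a}(a) = c`.
[cite: MadrasSlade1993, §3.1 (proof of Proposition 3.1.5: reflection in the hyperplane `x₁ = A₁(ω)`)] -/
def sigmaMap (c a y : Site d) : Site d := c + reflCoord 0 (y - a)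

/-- The reflection of the height fixes the origin. [folklore] -/
private theorem reflCoord_zero_zero : reflCoord (0 : ℤ) (0 : Site d) = 0 := by
  funext i
  by_cases hi : i = 0
  · subst hi; simp
  · simp [hi]

/-- `σ_{c,a}(a) = c`. [folklore] -/
private theorem sigmaMap_self (c a : Site d) : sigmaMap c a a = c := by
  rw [sigmaMap, sub_self, reflCoord_zero_zero, add_zero]

/-- The height of `σ_{c,a}(y)` is `X(c) + X(a) − X(y)`. [folklore] -/
private theorem sigmaMap_apply_zero (c a y : Site d) : sigmaMap c a y 0 = c 0 + a 0 - y 0 := by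
  simp only [sigmaMap, Pi.add_apply, reflCoord_apply_zero, Pi.sub_apply]
  ring

/-- `σ_{c,a}` is injective. [folklore] -/
private theorem sigmaMap_injective (c a : Site d) : Function.Injective (sigmaMap c a) := by
  intro y y' h
  have h1 := add_left_cancel h
  have h2 := reflCoord_injective (d := d) 0 h1
  exact sub_left_injective h2

/-- `σ_{c,a}` is an automorphism of `ℤ^d` (reflection of the first coordinate and translations are).
[cite: MadrasSlade1993, §3.1 (proof of Proposition 3.1.5)] -/
theorem sigmaMap_adj {c a y y' : Site d} (h : (zdGraph d).Adj y y') :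
    (zdGraph d).Adj (sigmaMap c a y) (sigmaMap c a y') := by
  have h1 := (zdGraph_adj_sub_right y y' a).2 h
  have h2 := zdGraph_adj_reflCoord 0 h1
  have h3 := (zdGraph_adj_add_right _ _ c).2 h2
  simpa only [sigmaMap, add_comm c] using h3

/-! ### The insertion map -/

/-- **Insert the bridge `β` into `ω` at time `j`**: `ω[0..j]`, then the translated bridge `ω(j) + β`, then the
image of `ω[j+1..]` under `σ_{c,a}` with `a = ω(j+1)` and `c = ω(j) + β(M) − (ω(j+1) − ω(j))` (so that the
reflected tail starts one step `−w` off the top of the bridge); for `j = n` (the length of `ω`) this is the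
concatenation `ω · β`.
[cite: MadrasSlade1993, §8.1 (proof of Proposition 8.1.2, Fig. 8.1: the reflection `T_M`), §1.2 eq. (1.2.15)] -/
def insertBridge (j M : ℕ) (ω β : ℕ → Site d) : ℕ → Site d := fun i =>
  if i ≤ j then ω i
  else if i ≤ j + M then ω j + β (i - j)
  else sigmaMap (ω j + β M + (ω j - ω (j + 1))) (ω (j + 1)) (ω (i - M))

variable {j M n : ℕ} {ω β : ℕ → Site d}

/-- Values of the insertion map up to time `j`. [folklore] -/
private theorem insertBridge_of_le {i : ℕ} (h : i ≤ j) : insertBridge j M ω β i = ω i := by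
  simp [insertBridge, h]

/-- Values of the insertion map inside the bridge. [folklore] -/
private theorem insertBridge_mid {i : ℕ} (h1 : j < i) (h2 : i ≤ j + M) :
    insertBridge j M ω β i = ω j + β (i - j) := by
  simp [insertBridge, show ¬ i ≤ j by omega, h2]

/-- Values of the insertion map after the bridge. [folklore] -/
private theorem insertBridge_of_gt {i : ℕ} (h : j + M < i) :
    insertBridge j M ω β i = sigmaMap (ω j + β M + (ω j - ω (j + 1))) (ω (j + 1)) (ω (i - M)) := by
  simp [insertBridge, show ¬ i ≤ j by omega, show ¬ i ≤ j + M by omega]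

/-- **The inserted walk is an `(n+M)`-step self-avoiding walk of `ℤ^d`** when `j ≤ n` is the last time at which
the height of `ω` is maximal and `β` is a bridge: the blocks `ω[0..j]`, bridge, reflected tail occupy the height
ranges `≤ D`, `(D, D + X(β M)]`, `> D + X(β M)`.
[cite: MadrasSlade1993, §3.1 (proof of Proposition 3.1.5: "ω' … does not intersect …") and §1.2 eq. (1.2.15)] -/
theorem insertBridge_mem_saws (hω : ω ∈ saws d n) (hβ : β ∈ bridges d M) (hj : j ≤ n)
    (hmax : ∀ i ≤ n, ω i 0 ≤ ω j 0) (hlt : ∀ i, j < i → i ≤ n → ω i 0 < ω j 0) :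
    insertBridge j M ω β ∈ saws d (n + M) := by
  obtain ⟨h0, hend, hadj, hinj⟩ := mem_saws.1 hω
  obtain ⟨hβs, hβb⟩ := mem_bridges.1 hβ
  obtain ⟨hβ0, hβend, hβadj, hβinj⟩ := mem_saws.1 hβs
  have hβ00 : β 0 0 = 0 := by rw [hβ0]; rfl
  -- heights of the bridge
  have hβpos : ∀ t, 1 ≤ t → t ≤ M → 0 < β t 0 := fun t h1 h2 => hβ00 ▸ (hβb t h1 h2).1
  have hβM0 : 0 ≤ β M 0 := by
    rcases Nat.eq_zero_or_pos M with hM | hM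
    · rw [hM, hβ00]
    · exact (hβpos M hM le_rfl).le
  have hβtop : ∀ t ≤ M, β t 0 ≤ β M 0 := by
    intro t ht
    rcases Nat.eq_zero_or_pos t with rfl | hpos
    · rwa [hβ00]
    · exact (hβb t hpos ht).2
  -- the step out of the last maximum, re-based at an arbitrary point `q`
  have hstep : j < n → ∀ q : Site d, (zdGraph d).Adj q (q + (ω j - ω (j + 1))) := by
    intro hjn q
    have h1 := (hadj j hjn).symm
    have h2 := (zdGraph_adj_add_right (ω (j + 1)) (ω j) (q - ω (j + 1))).2 h1
    have e1 : ω (j + 1) + (q - ω (j + 1)) = q := by abel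
    have e2 : ω j + (q - ω (j + 1)) = q + (ω j - ω (j + 1)) := by abel
    rwa [e1, e2] at h2
  refine mem_saws.2 ⟨?_, ?_, ?_, ?_⟩
  · -- start
    rw [insertBridge_of_le (Nat.zero_le _), h0]
  · -- frozen after time `n + M`
    intro i hi
    rcases hj.lt_or_eq with hjn | hjn
    · rw [insertBridge_of_gt (by omega), insertBridge_of_gt (by omega), hend (i - M) (by omega),
        show n + M - M = n by omega]
    · -- `j = n`: plain concatenation
      subst hjn
      rcases hi.lt_or_eq with hi | hi
      · have ha : ω (j + 1) = ω j := hend (j + 1) (by omega)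
        rw [insertBridge_of_gt hi, hend (i - M) (by omega), ha, sigmaMap_self, sub_self, add_zero]
        rcases Nat.eq_zero_or_pos M with hM | hM
        · subst hM
          rw [insertBridge_of_le (by omega), Nat.add_zero, hβ0, add_zero]
        · rw [insertBridge_mid (by omega) le_rfl, show j + M - j = M by omega]
      · rw [hi]
  · -- adjacency
    intro i hi
    rcases Nat.lt_or_ge (i + 1) (j + 1) with h1 | h1
    · -- both times `≤ j`
      rw [insertBridge_of_le (by omega : i ≤ j), insertBridge_of_le (by omega : i + 1 ≤ j)]
      exact hadj i (by omega)
    rcases Nat.lt_or_ge i (j + M) with h2 | h2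
    · -- inside the bridge (`M ≥ 1`)
      rcases (show j ≤ i by omega).eq_or_lt with h3 | h3
      · subst h3
        rw [insertBridge_of_le le_rfl, insertBridge_mid (by omega) (by omega),
          show j + 1 - j = 1 by omega]
        have := (zdGraph_adj_add_right (β 0) (β 1) (ω j)).2 (hβadj 0 (by omega))
        rwa [hβ0, zero_add, add_comm] at this
      · rw [insertBridge_mid h3 h2.le, insertBridge_mid (by omega) (by omega),
          show i + 1 - j = (i - j) + 1 by omega, add_comm (ω j) (β (i - j)), add_comm (ω j),
          zdGraph_adj_add_right]
        exact hβadj (i - j) (by omega)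
    · -- at or after the top of the bridge; here `j < n`
      have hjn : j < n := by omega
      rcases h2.eq_or_lt with h3 | h3
      · -- the joint `p' → σ(ω(j+1)) = p' − w`
        rw [← h3, insertBridge_of_gt (by omega : j + M < j + M + 1),
          show j + M + 1 - M = j + 1 by omega, sigmaMap_self]
        rcases Nat.eq_zero_or_pos M with hM | hM
        · subst hM
          rw [insertBridge_of_le (by omega), Nat.add_zero, hβ0, add_zero]
          exact hstep hjn _
        · rw [insertBridge_mid (by omega) le_rfl, show j + M - j = M by omega]
          exact hstep hjn _
      · -- inside the reflected tail
        rw [insertBridge_of_gt h3, insertBridge_of_gt (by omega),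
          show i + 1 - M = (i - M) + 1 by omega]
        exact sigmaMap_adj (hadj (i - M) (by omega))
  · -- injectivity on `[0, n + M]`: heights separate the three blocks
    have hA : ∀ i ≤ j, insertBridge j M ω β i 0 ≤ ω j 0 := fun i hi => by
      rw [insertBridge_of_le hi]; exact hmax i (by omega)
    have hBlo : ∀ i, j < i → i ≤ j + M → ω j 0 < insertBridge j M ω β i 0 := fun i hi1 hi2 => by
      rw [insertBridge_mid hi1 hi2, Pi.add_apply]
      linarith [hβpos (i - j) (by omega) (by omega)]
    have hBhi : ∀ i, j < i → i ≤ j + M → insertBridge j M ω β i 0 ≤ ω j 0 + β M 0 := fun i hi1 hi2 => by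
      rw [insertBridge_mid hi1 hi2, Pi.add_apply]
      linarith [hβtop (i - j) (by omega)]
    have hC : ∀ i, j + M < i → i ≤ n + M → ω j 0 + β M 0 < insertBridge j M ω β i 0 := fun i hi1 hi2 => by
      rw [insertBridge_of_gt hi1, sigmaMap_apply_zero]
      simp only [Pi.add_apply, Pi.sub_apply]
      linarith [hlt (i - M) (by omega) (by omega)]
    intro a ha b hb hab
    simp only [Set.mem_setOf_eq] at ha hb
    have h0 : insertBridge j M ω β a 0 = insertBridge j M ω β b 0 := by rw [hab]
    rcases le_or_gt a j with ha1 | ha1 <;> rcases le_or_gt b j with hb1 | hb1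
    · rw [insertBridge_of_le ha1, insertBridge_of_le hb1] at hab
      exact hinj (show a ≤ n by omega) (show b ≤ n by omega) hab
    · exfalso
      rcases le_or_gt b (j + M) with hb2 | hb2
      · linarith [hA a ha1, hBlo b hb1 hb2]
      · linarith [hA a ha1, hC b hb2 hb]
    · exfalso
      rcases le_or_gt a (j + M) with ha2 | ha2
      · linarith [hA b hb1, hBlo a ha1 ha2]
      · linarith [hA b hb1, hC a ha2 ha]
    · rcases le_or_gt a (j + M) with ha2 | ha2 <;> rcases le_or_gt b (j + M) with hb2 | hb2
      · rw [insertBridge_mid ha1 ha2, insertBridge_mid hb1 hb2] at hab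
        have e := hβinj (show a - j ≤ M by omega) (show b - j ≤ M by omega) (add_left_cancel hab)
        omega
      · exfalso; linarith [hBhi a ha1 ha2, hC b hb2 hb]
      · exfalso; linarith [hBhi b hb1 hb2, hC a ha2 ha]
      · rw [insertBridge_of_gt ha2, insertBridge_of_gt hb2] at hab
        have e := hinj (show a - M ≤ n by omega) (show b - M ≤ n by omega) (sigmaMap_injective _ _ hab)
        omega

/-- **For fixed `j` and `M` the insertion map is injective** on pairs (walk, bridge-like function starting
at `0` and frozen after `M`): the step after time `j + M` returns the step out of the maximum, which
determines `σ`. [cite: MadrasSlade1993, §8.1 (proof of Proposition 8.1.2: "ζ uniquely determines the original polygon")] -/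
theorem insertBridge_injective {ω' β' : ℕ → Site d} (hβ : β ∈ saws d M) (hβ' : β' ∈ saws d M)
    (h : insertBridge j M ω β = insertBridge j M ω' β') : ω = ω' ∧ β = β' := by
  obtain ⟨hβ0, hβend, -, -⟩ := mem_saws.1 hβ
  obtain ⟨hβ'0, hβ'end, -, -⟩ := mem_saws.1 hβ'
  have hA : ∀ i ≤ j, ω i = ω' i := fun i hi => by
    have e := congrFun h i
    rwa [insertBridge_of_le hi, insertBridge_of_le hi] at e
  have hωj := hA j le_rfl
  have hB : ∀ t, 1 ≤ t → t ≤ M → β t = β' t := fun t h1 h2 => by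
    have e := congrFun h (j + t)
    rw [insertBridge_mid (by omega) (by omega), insertBridge_mid (by omega) (by omega),
      show j + t - j = t by omega, hωj] at e
    exact add_left_cancel e
  have hββ : β = β' := by
    funext t
    rcases Nat.eq_zero_or_pos t with ht | ht
    · rw [ht, hβ0, hβ'0]
    rcases le_or_gt t M with h2 | h2
    · exact hB t ht h2
    · rw [hβend t h2.le, hβ'end t h2.le]
      rcases Nat.eq_zero_or_pos M with hM | hM
      · rw [hM, hβ0, hβ'0]
      · exact hB M hM le_rfl
  have hβM : β M = β' M := by rw [hββ]
  have hj1 : ω (j + 1) = ω' (j + 1) := by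
    have e := congrFun h (j + M + 1)
    rw [insertBridge_of_gt (by omega), insertBridge_of_gt (by omega), show j + M + 1 - M = j + 1 by omega,
      sigmaMap_self, sigmaMap_self, hωj, hβM] at e
    exact sub_right_inj.1 (add_left_cancel e)
  have hC : ∀ k, j < k → ω k = ω' k := fun k hk => by
    have e := congrFun h (k + M)
    rw [insertBridge_of_gt (by omega), insertBridge_of_gt (by omega), show k + M - M = k by omega,
      hωj, hβM, hj1] at e
    exact sigmaMap_injective _ _ e
  refine ⟨funext fun k => ?_, hββ⟩
  rcases le_or_gt k j with hk | hk
  · exact hA k hk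
  · exact hC k hk

/-! ### The classes by the last time of maximal height -/

open Classical in
/-- The `n`-step walks of `ℤ^d` whose LAST time of maximal first coordinate is `j`. [cite: MadrasSlade1993, §3.1 (proof of
Proposition 3.1.5: `n₁(ω)`, "the largest value of `i` for which this maximum is attained")] -/
def lastMaxClass (n j : ℕ) : Finset (ℕ → Site d) :=
  (saws d n).filter fun ω => (∀ i ≤ n, ω i 0 ≤ ω j 0) ∧ ∀ i, j < i → i ≤ n → ω i 0 < ω j 0

/-- Membership in `lastMaxClass`. [cite: MadrasSlade1993, §3.1 (proof of Proposition 3.1.5)] -/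
theorem mem_lastMaxClass {n j : ℕ} {ω : ℕ → Site d} :
    ω ∈ lastMaxClass (d := d) n j ↔
      ω ∈ saws d n ∧ (∀ i ≤ n, ω i 0 ≤ ω j 0) ∧ ∀ i, j < i → i ≤ n → ω i 0 < ω j 0 := by
  classical
  exact Finset.mem_filter

open Classical in
/-- Every walk lies in the class of its last time of maximal height (the tree's `lastArgmax`).
[cite: MadrasSlade1993, §3.1 (proof of Proposition 3.1.5)] -/
theorem saws_subset_biUnion_lastMaxClass (n : ℕ) :
    saws d n ⊆ (Finset.range (n + 1)).biUnion (lastMaxClass (d := d) n) := by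
  classical
  intro ω hω
  rw [Finset.mem_biUnion]
  obtain ⟨hjn, hjmax⟩ := lastArgmax_spec n ω
  refine ⟨lastArgmax n ω, Finset.mem_range.2 (by omega),
    mem_lastMaxClass.2 ⟨hω, fun i hi => ?_, fun i h1 h2 => ?_⟩⟩
  · rw [hjmax]; exact apply_le_maxLevel ω hi
  · rw [hjmax]; exact apply_lt_maxLevel_of_lastArgmax_lt ω h1 h2

/-- **Class × bridges injects into `(n+M)`-step walks**: `#(lastMaxClass n j) · b_M ≤ c_{n+M}` for `j ≤ n`.
[cite: MadrasSlade1993, §1.2 eq. (1.2.15) and §3.1 (proof of Proposition 3.1.5)] -/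
theorem card_lastMaxClass_mul_bridgeCount_le {n j : ℕ} (hj : j ≤ n) (M : ℕ) :
    #(lastMaxClass (d := d) n j) * bridgeCount d M ≤ count d (n + M) := by
  classical
  rw [bridgeCount, ← Finset.card_product, ← card_saws d (n + M)]
  refine Finset.card_le_card_of_injOn (fun p => insertBridge j M p.1 p.2) ?_ ?_
  · rintro ⟨ω, β⟩ hp
    simp only [Finset.mem_coe, Finset.mem_product, mem_lastMaxClass] at hp
    obtain ⟨⟨hω, hmax, hlt⟩, hβ⟩ := hp
    show insertBridge j M ω β ∈ (saws d (n + M) : Set (ℕ → Site d))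
    rw [Finset.mem_coe]
    exact insertBridge_mem_saws hω hβ hj hmax hlt
  · rintro ⟨ω, β⟩ hp ⟨ω', β'⟩ hp' h
    simp only [Finset.mem_coe, Finset.mem_product, mem_lastMaxClass, mem_bridges] at hp hp'
    obtain ⟨hωω, hββ⟩ := insertBridge_injective hp.2.1 hp'.2.1 h
    exact Prod.ext hωω hββ

end BridgeInsertion

open BridgeInsertion

/-! ### The insertion inequality -/

/-- **`c_n · b_M ≤ (n+1) · c_{n+M}`** on `ℤ^d`, every `d ≥ 1`, all `n, M`: an `M`-step bridge can be inserted into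
any `n`-step self-avoiding walk at the last time of maximal first coordinate (reflecting the rest of the walk above
the bridge), injectively once that time is known.  With submultiplicativity this sandwiches `c_{n+M}` between
`c_n b_M/(n+1)` and `c_n c_M`.
[cite: MadrasSlade1993, Lemma 7.3.3 and §7.5 eqs. (7.5.1)–(7.5.2) (the role of such an inequality); §8.1
(proof of Proposition 8.1.2, Fig. 8.1) and §1.2 eq. (1.2.15) (the two devices: reflection after the maximum,
concatenation with a bridge)] -/
theorem count_mul_bridgeCount_le (n M : ℕ) :
    count d n * bridgeCount d M ≤ (n + 1) * count d (n + M) := by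
  classical
  have h1 : #(saws d n) ≤ ∑ j ∈ Finset.range (n + 1), #(lastMaxClass (d := d) n j) :=
    (Finset.card_le_card (saws_subset_biUnion_lastMaxClass n)).trans
      (Finset.card_biUnion_le (s := Finset.range (n + 1)) (t := lastMaxClass (d := d) n))
  rw [card_saws] at h1
  calc count d n * bridgeCount d M
      ≤ (∑ j ∈ Finset.range (n + 1), #(lastMaxClass (d := d) n j)) * bridgeCount d M :=
        Nat.mul_le_mul_right _ h1
    _ = ∑ j ∈ Finset.range (n + 1), #(lastMaxClass (d := d) n j) * bridgeCount d M := Finset.sum_mul _ _ _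
    _ ≤ ∑ j ∈ Finset.range (n + 1), count d (n + M) :=
      Finset.sum_le_sum fun j hj =>
        card_lastMaxClass_mul_bridgeCount_le (Nat.le_of_lt_succ (Finset.mem_range.1 hj)) M
    _ = (n + 1) * count d (n + M) := by rw [Finset.sum_const, Finset.card_range, smul_eq_mul]

/-- `c_n · b_M ≤ (n+1) · c_{n+M}` on `ℤ^d`, over `ℝ`. [cite: MadrasSlade1993, §7.5 eqs. (7.5.1)–(7.5.2)] -/
theorem count_mul_bridgeCount_le_real (n M : ℕ) :
    (count d n : ℝ) * bridgeCount d M ≤ ((n : ℝ) + 1) * count d (n + M) := by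
  exact_mod_cast count_mul_bridgeCount_le (d := d) n M

/-- **The sandwich** `c_n · b_M ≤ (n+1) · c_{n+M} ≤ (n+1) · c_n · c_M` (insertion inequality and
submultiplicativity `count_add_le`). [cite: MadrasSlade1993, eq. (1.2.3) and §7.5 eqs. (7.5.1)–(7.5.2)] -/
theorem count_mul_bridgeCount_le_and (n M : ℕ) :
    count d n * bridgeCount d M ≤ (n + 1) * count d (n + M) ∧
      (n + 1) * count d (n + M) ≤ (n + 1) * (count d n * count d M) :=
  ⟨count_mul_bridgeCount_le n M, Nat.mul_le_mul_left _ (count_add_le d n M)⟩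

end Literature.Probability.RandomPlanarGeometry.SAW.Zd
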